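import Literature.NumberTheory.DiophantineGeometry.GenEllProjLineExamples
import HarnessLib

/-!
# [GenEll] Ex. 1.3 (ii): the membership predicate `CBData.Mem` — INSTANCE FORMS (FACT-LIST row F-2763)

S. Mochizuki, *Arithmetic elliptic curves in general position*, Math. J. Okayama Univ. **52** (2010)
[cite: MochizukiGenEll2010], Example 1.3 (ii) pp. 5–6: a compactly bounded subset `K_V ⊆ U_P(ℚ̄)` and
its membership condition "the set of `[F:ℚ]` points … determined by `x` is contained in `K_v`".
PROOF-ONLY companion (theorems only; no `def`) of `GenEllProjLine.lean` (the predicate `CBData.Mem`,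
abc-iut typing) and `GenEllProjLineExamples.lean` (the standard compactly bounded subset `CBData.std`).

Bookkeeping context (abc-iut cell, block F, row INST59C of the LF kernel census): the universal closure
of F-2763 is REFUTED in tree (`CBData.not_forall_mem`, `not_forall_cbData_mem` — the cusp `λ = 0` lies
in no `K_V`) and the row is model-witnessed by `∃`-statements (`exists_cbData_mem`) and by
`CBData.ratPoint_half_mem`, whose conclusion is phrased through `CBData.toSet`.  This file records the
same content with conclusion head LITERALLY the FACT-LIST declaration
`Literature.NumberTheory.DiophantineGeometry.GenEll.CBData.Mem` (instance forms), so that the kernel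
census sees it by name:

* `CBData.mem_std_ratPoint_half` — for every finite set `S` of primes, the `ℚ`-point `λ = 1/2` is a
  member of the standard compactly bounded subset with support `{∞} ∪ S`;
* `CBData.mem_std_empty_ratPoint_half` — the closed instance `S = ∅` (no binders);
* `CBData.mem_of_mem_toSet` / `CBData.mem_iff_mem_toSet` — the (definitional) bridge between the two
  phrasings, for consumers.

`Mem` is vocabulary (a membership PREDICATE), so "instance form" here only means: the predicate is
satisfiable at the tree's standard data, non-vacuously.  Nothing of [GenEll] is strengthened; nothing
here bears on [IUTchIII] Cor. 3.12; typed ≠ proved.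
-/

namespace Literature.NumberTheory.DiophantineGeometry.GenEll

namespace CBData

/-- Bridge (definitional): membership in the set `K_V = D.toSet` is the predicate `D.Mem`.
[cite: MochizukiGenEll2010, Ex 1.3 (ii) p.6] -/
theorem mem_of_mem_toSet {D : CBData} {P : NFPoint} (h : P ∈ D.toSet) :
    Literature.NumberTheory.DiophantineGeometry.GenEll.CBData.Mem D P :=
  h

/-- Bridge (definitional), as an `iff`. [cite: MochizukiGenEll2010, Ex 1.3 (ii) p.6] -/
theorem mem_iff_mem_toSet (D : CBData) (P : NFPoint) :
    Literature.NumberTheory.DiophantineGeometry.GenEll.CBData.Mem D P ↔ P ∈ D.toSet :=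
  Iff.rfl

/-- **F-2763, INSTANCE FORM** at the standard compactly bounded subset with support `{∞} ∪ S`
(`K_∞ = {|z − 1/2| ≤ 1/4}`, `K_p = {‖y − 1/2‖ ≤ ‖p‖}`): the `ℚ`-rational point `λ = 1/2` is a member
(every embedding sends `1/2` to the centre of each ball).  Restates `CBData.ratPoint_half_mem` with
conclusion head `CBData.Mem`. [cite: MochizukiGenEll2010, Ex 1.3 (ii) p.6] -/
theorem mem_std_ratPoint_half (S : Finset ℕ) (hS : ∀ p ∈ S, p.Prime) :
    Literature.NumberTheory.DiophantineGeometry.GenEll.CBData.Mem (std S hS) (ratPoint 2⁻¹) :=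
  ratPoint_half_mem S hS

/-- **F-2763, CLOSED INSTANCE** (no binders): `λ = 1/2` lies in the standard compactly bounded subset
with support `{∞}` (no nonarchimedean primes). [cite: MochizukiGenEll2010, Ex 1.3 (ii) p.6] -/
theorem mem_std_empty_ratPoint_half :
    Literature.NumberTheory.DiophantineGeometry.GenEll.CBData.Mem
      (std ∅ fun _ h => absurd h (Finset.notMem_empty _)) (ratPoint 2⁻¹) :=
  ratPoint_half_mem ∅ _

/-- Non-vacuity of the instance: the same standard subset does NOT contain every point (the cusp
`λ = 0` is excluded), so `Mem (std ∅ _)` is a genuine predicate with both truth values.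
[cite: MochizukiGenEll2010, Ex 1.3 (ii) p.6] -/
theorem mem_std_empty_ratPoint_half_and_not_zero :
    Literature.NumberTheory.DiophantineGeometry.GenEll.CBData.Mem
        (std ∅ fun _ h => absurd h (Finset.notMem_empty _)) (ratPoint 2⁻¹) ∧
      ¬ Literature.NumberTheory.DiophantineGeometry.GenEll.CBData.Mem
        (std ∅ fun _ h => absurd h (Finset.notMem_empty _)) (ratPoint 0) :=
  ⟨mem_std_empty_ratPoint_half, fun h => (inU_of_mem h).1 rfl⟩

end CBData

end Literature.NumberTheory.DiophantineGeometry.GenEll
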